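/-
Copyright: the b2b-balaban T⁴-continuum CRUX team, row NE7b leaf lineage `t4-ne7b-formalise-leaf-06` (gen 151). Project licence.
-/
import Mathlib.Analysis.Complex.Liouville
import Mathlib.Analysis.Complex.RealDeriv
import Mathlib.Analysis.Calculus.IteratedDeriv.Lemmas
import Mathlib.Analysis.Calculus.ContDiff.Basic
import Literature.Analysis.Calculus.IteratedFDerivSymmetric

/-!
# THE THIRD-DERIVATIVE LETTER FROM ANALYTICITY: a functional holomorphic and bounded by `M` on a complex `δ`-neighbourhood has a
# real part with `|Dⁿ(Re E)(p)[z,…,z]| ≤ (n!·M∕δⁿ)‖z‖ⁿ` for EVERY order `n ≥ 1`, and at order three `|D³(Re E)(p)[u,v,w]| ≤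
# (27M∕δ³)‖u‖‖v‖‖w‖`, `‖D³(Re E)(p)‖ ≤ 27M∕δ³` — Cauchy's inequality on complex lines, Schwarz symmetry and cubic polarization
# (row NE7b, node U5c; the SUPPLIER of the convexity road's displayed third-derivative letter `c₃` from the currency print states
# its effective actions in; the order-three sibling of `…AnalyticHessianLetter` ∕ `…AnalyticGradientLetter`)

Cell `pub-balaban`, sub-cell `t4`, spine estimate NE7b (`T4WeightBudget.RelWeightBound`; the cell's OWN estimate — NOT PRINTED in
[Bałaban 1983–89], NOT PROVED).  Crux-route work under `Spine/NE7b/` by a row leaf on the convexity road; NOTHING of Bałaban's is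
named, valued or asserted; no `T4Continuum/Support` leaf typed; no `def`; zero `sorry`.  Imports: Mathlib and the tree's all-orders
Schwarz–Clairaut theorem `Literature.Analysis.Calculus.IteratedFDerivSymmetric` (built) — independent of the `Spine/NE7b` olean
frontier (the siblings' one-variable ∕ slice ∕ chart plumbing is re-derived here at EVERY order `n`; they state it at `n = 1, 2`).

WHY.  Besides Hessian letters the windowed convexity road displays a THIRD-DERIVATIVE letter and leaves it to «the instance»
((A3) ∕ (A1c), NC-NE7b-α UNRULED): the OWNER's `…ConvexWindowSuppliers` §3 (`hP3 : ∀ x ∈ K, ‖iteratedFDeriv ℝ 3 P x‖ ≤ c₃` ⟹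
modulus `2σ − c₃ρ` ON a window of radius `ρ` — «the window is small, so the anharmonic Hessian is small»),
`…ConvexWindowSuppliersBox` §3 (`|D³P(z)[w,u,v]| ≤ c·N(w)‖u‖‖v‖`), `…ConvexWindowSuppliersLocal` (the coordinate table
`|D³P(z)[e_a,e_b,e_c]| ≤ M`).  Print and the template state their effective actions as ANALYTIC functionals with a SUP BOUND on a
complex neighbourhood of the small-field region ([B12] = Bałaban, CMP 109 (1987) §1 (1.13) ∕ (1.18); Dimock's template I §4 — read
BY SHAPE only, nothing asserted); Cauchy's inequality on complex lines converts one sup bound into every derivative (`k!·M∕δᵏ` on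
the diagonal).  The siblings typed `k = 1, 2`; THIS FILE types the diagonal at every `k` and the full (mixed, operator-norm) letter
at `k = 3`, so that `c₃` is owed in print's own currency: `c₃ = 27M∕δ³` (`27 = 3³`, several-variable Cauchy ∕ cubic polarization).

WHAT IS PROVED ([folklore]: Cauchy's inequalities [Hörmander 1973, Thm 2.2.7] — `Complex.norm_iteratedDeriv_le_of_forall_mem_sphere_norm_le`
BY NAME; the chain rule for iterated derivatives along lines; Schwarz–Clairaut for `D³` — `iteratedFDeriv_comp_perm_of_le` BY NAME):
* §1 ONE COMPLEX VARIABLE, EVERY ORDER: `iteratedDeriv_re_ofReal` (`(Re g)⁽ⁿ⁾ = Re g⁽ⁿ⁾` at real points of an open `S` on which `g`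
  is holomorphic), `abs_iteratedDeriv_re_le` (`|(Re g)⁽ⁿ⁾(s₀)| ≤ n!·M∕rⁿ` from `‖g‖ ≤ M` on the circle of radius `r`).
* §2 LINE SLICES, EVERY ORDER (real normed `V`, `P ∈ Cⁿ` on an open `O ∋ x`): **`iteratedDeriv_lineSlice`**
  (`(s ↦ P(x + s v))⁽ⁿ⁾(0) = DⁿP(x)[v,…,v]`, i.e. `iteratedFDeriv ℝ n P x (fun _ => v)`); THE MECHANISM
  `abs_iteratedFDeriv_diag_le_of_holomorphicSlice` (`|DⁿP(x)[v,…,v]| ≤ n!·M∕rⁿ` when the slice is the real trace of a `g` holomorphic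
  on an open `S ⊇ closedBall 0 r` with `‖g‖ ≤ M` on `|t| = r`).
* §3 THROUGH A REAL-LINEAR CHART `J : V →L[ℝ] W` (`P y = Re E(J y)`, `E ∈ Cⁿ(U)` over `ℂ`, `n ≠ 0`, `‖E‖ ≤ M` on `U`):
  `abs_iteratedFDeriv_diag_chart_le_of_disc` (ANY `J`, disc form; `P ∈ Cⁿ(J⁻¹U)` inside), and for a CONTRACTIVE chart
  (`‖J v‖ ≤ ‖v‖`) with `closedBall (J x) δ ⊆ U`: **`abs_iteratedFDeriv_diag_chart_le`** (`|DⁿP(x)[v,…,v]| ≤ (n!·M∕δⁿ)‖v‖ⁿ`).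
* §4 ORDER THREE: `iteratedFDeriv_three_apply` (`D³P(x)[m] = D(D(DP))(x)(m 0)(m 1)(m 2)`), `fderiv_three_symm` (Schwarz),
  **`polarization_three`** (`24·D³P(x)[u,v,w] = D(u+v+w) − D(u+v−w) − D(u−v+w) + D(u−v−w)`, `D(z) := D³P(x)[z,z,z]`), and the
  letters **`abs_fderiv_three_chart_le`** ∕ `abs_iteratedFDeriv_three_chart_le` (`|D³P(x)[u,v,w]| ≤ (27M∕δ³)‖u‖‖v‖‖w‖`),
  **`norm_iteratedFDeriv_three_chart_le`** (`‖D³P(x)‖ ≤ 27M∕δ³`) and THE ROAD's WINDOW LETTER **`thirdDerivOn_chart_norm_le`**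
  (`∀ x ∈ K, ‖iteratedFDeriv ℝ 3 P x‖ ≤ 27M∕δ³` once `closedBall (J x) δ ⊆ U` for `x ∈ K` — the `hP3` shape, `c₃ = 27M∕δ³`).
* §5 `J = id` on `W`: `abs_iteratedFDeriv_diag_re_le`, `norm_iteratedFDeriv_three_re_le`.  §6 LATTICE FIELDS (`ι → ℝ ↪ ι → ℂ`, SUP
  norms, closed balls = polydiscs): **`norm_iteratedFDeriv_three_lattice_le`**, the coordinate TABLE
  `abs_iteratedFDeriv_three_lattice_single_le` (`|D³P(x)[e_a,e_b,e_c]| ≤ 27M∕δ³`).  §7 a toy (`E z = z³` on `ball 0 2`, `M = 8`, `δ = 1`).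

NOT HERE (honest): the sharper polydisc constants for coordinate partials (several-variable Cauchy is not in Mathlib; one complex
line gives `27M∕δ³`); mixed letters of order `≥ 4`; the GLOBAL `C³` letter some sockets display (`ContDiff ℝ 3 P` — a cutoff ∕
extension matter; here: `ContDiffOn` on `J⁻¹ U` and the letters AT the points whose complex `δ`-ball lies in `U`); the `ℓ²`
spellings (the contractive chart covers `ℓ² → ℓ^∞`); WHICH functional of print is analytic on WHICH neighbourhood with WHICH
`(M, δ)`, and the subtraction of the inherited marginal ∕ relevant terms (gauge invariance, counter-terms) before such a bound is
worth having — the (A3) ∕ (A1c) readings, NC-NE7b-α UNRULED; anything of Bałaban's.  BY-NAME EFFECT ON THE WALL: NONE (a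
supplier for displayed letters).  NE7b NOT PRINTED ∕ NOT PROVED; spine PROVED 0∕9; rung (B)+1 on a FINITE torus — NOT infinite
volume, NOT the mass gap, NOT Clay.
HONEST DEPENDENCY: continuum YM on T⁴ ⇐ BetaPertH ∧ nine spine estimates (0/9 proved); BetaPertH ⇐ (D1) ∧ (D4) ∧ CAP+tail.
-/

set_option autoImplicit false

open Set Filter Metric Topology

namespace Summit.QuantumFields.BalabanUV.T4Continuum.NE7b.AnalyticThirdDerivLetter

/-! ## §1 One complex variable, every order: real traces and Cauchy's inequality -/

section OneVariable

variable {S : Set ℂ}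

/-- `(Re g)⁽ⁿ⁾(s₀) = Re g⁽ⁿ⁾(s₀)` at the real points of an open `S` on which `g` is holomorphic — every order `n` (the derivatives
`g′, g″, …` are again holomorphic on `S`). [folklore] -/
theorem iteratedDeriv_re_ofReal (hS : IsOpen S) (n : ℕ) :
    ∀ {g : ℂ → ℂ}, DifferentiableOn ℂ g S → ∀ {s₀ : ℝ}, (s₀ : ℂ) ∈ S →
      iteratedDeriv n (fun s : ℝ => (g s).re) s₀ = (iteratedDeriv n g s₀).re := by
  induction n with
  | zero => intro g _ s₀ _; simp
  | succ n ih =>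
      intro g hg s₀ h0
      have hev : ∀ᶠ s : ℝ in 𝓝 s₀, (s : ℂ) ∈ S :=
        Complex.continuous_ofReal.continuousAt.preimage_mem_nhds (hS.mem_nhds h0)
      have hd1 : deriv (fun s : ℝ => (g s).re) =ᶠ[𝓝 s₀] fun s => (deriv g s).re :=
        hev.mono fun s hs => ((hg.differentiableAt (hS.mem_nhds hs)).hasDerivAt.real_of_complex).deriv
      have hg' : DifferentiableOn ℂ (deriv g) S := ((hg.analyticOnNhd hS).deriv).differentiableOn
      rw [iteratedDeriv_succ', iteratedDeriv_succ', hd1.iteratedDeriv_eq]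
      exact ih hg' h0

/-- **CAUCHY'S INEQUALITY AT ORDER `n`, REAL TRACE**: `|(Re g)⁽ⁿ⁾(s₀)| ≤ n!·M∕rⁿ` for `g` holomorphic on an open
`S ⊇ closedBall s₀ r` with `‖g‖ ≤ M` on the circle `|t − s₀| = r` (Mathlib's `Complex.norm_iteratedDeriv_le_of_forall_mem_sphere_norm_le`
BY NAME: `‖g⁽ⁿ⁾(s₀)‖ ≤ n!·M∕rⁿ`). [folklore] -/
theorem abs_iteratedDeriv_re_le (hS : IsOpen S) {g : ℂ → ℂ} (hg : DifferentiableOn ℂ g S) (n : ℕ) {s₀ : ℝ} {r M : ℝ}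
    (hr : 0 < r) (hsub : closedBall (s₀ : ℂ) r ⊆ S) (hM : ∀ t ∈ sphere (s₀ : ℂ) r, ‖g t‖ ≤ M) :
    |iteratedDeriv n (fun s : ℝ => (g s).re) s₀| ≤ n.factorial * M / r ^ n := by
  rw [iteratedDeriv_re_ofReal hS n hg (hsub (mem_closedBall_self hr.le))]
  exact (Complex.abs_re_le_norm _).trans
    (Complex.norm_iteratedDeriv_le_of_forall_mem_sphere_norm_le n hr (hg.diffContOnCl_ball hsub) hM)

end OneVariable

/-! ## §2 Line slices of a `Cⁿ` function on a real normed space, every order, and THE MECHANISM -/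

section LineSlice

variable {V : Type*} [NormedAddCommGroup V] [NormedSpace ℝ V] {F : Type*} [NormedAddCommGroup F] [NormedSpace ℝ F]

/-- **`(s ↦ P(x + s v))⁽ⁿ⁾(0) = DⁿP(x)[v, …, v]`** for `P` of class `Cⁿ` on an open `O ∋ x` (the slice is `P(x + ·)` composed with
the linear map `s ↦ s·v`; Mathlib's chain rule for iterated derivatives within the open preimage, then translation). [folklore] -/
theorem iteratedDeriv_lineSlice {P : V → F} {O : Set V} (hO : IsOpen O) {n : ℕ} (hP : ContDiffOn ℝ n P O) {x : V}
    (hx : x ∈ O) (v : V) : iteratedDeriv n (fun s : ℝ => P (x + s • v)) 0 = iteratedFDeriv ℝ n P x (fun _ => v) := by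
  set L : ℝ →L[ℝ] V := (1 : ℝ →L[ℝ] ℝ).smulRight v with hL
  have hLs : ∀ s : ℝ, L s = s • v := fun s => by simp [hL]
  set O' : Set V := (fun y => x + y) ⁻¹' O with hO'
  have hO'o : IsOpen O' := hO.preimage (by fun_prop)
  have hPx : ContDiffOn ℝ n (fun y => P (x + y)) O' :=
    hP.comp (contDiff_const.add contDiff_id).contDiffOn (mapsTo_preimage _ _)
  have h0 : L 0 ∈ O' := by simpa [hLs, hO'] using hx
  have hLo : IsOpen (L ⁻¹' O') := hO'o.preimage L.continuous
  have hslice : (fun s : ℝ => P (x + s • v)) = (fun y => P (x + y)) ∘ L := by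
    funext s; simp [hLs]
  have e1 : iteratedFDeriv ℝ n ((fun y => P (x + y)) ∘ L) 0 = iteratedFDerivWithin ℝ n ((fun y => P (x + y)) ∘ L) (L ⁻¹' O') 0 :=
    (iteratedFDerivWithin_of_isOpen n hLo h0).symm
  have e2 := L.iteratedFDerivWithin_comp_right hPx hO'o.uniqueDiffOn hLo.uniqueDiffOn h0 (i := n) le_rfl
  have e3 : iteratedFDerivWithin ℝ n (fun y => P (x + y)) O' (L 0) = iteratedFDeriv ℝ n (fun y => P (x + y)) (L 0) :=
    iteratedFDerivWithin_of_isOpen n hO'o h0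
  rw [iteratedDeriv_eq_iteratedFDeriv, hslice, e1, e2, ContinuousMultilinearMap.compContinuousLinearMap_apply, e3,
    iteratedFDeriv_comp_add_left]
  simp [hLs]

/-- **THE CAUCHY MECHANISM FOR ONE DIRECTION, ORDER `n`.**  `P : V → ℝ` is `Cⁿ` on an open `O ∋ x`; along `v` its slice is the real
trace of a function `g` holomorphic on an open `S ⊇ closedBall 0 r` — `P(x + s v) = Re g(s)` for real `s` with `↑s ∈ S` — and
`‖g‖ ≤ M` on the circle `|t| = r`.  Then `|DⁿP(x)[v, …, v]| ≤ n!·M∕rⁿ`. [folklore] -/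
theorem abs_iteratedFDeriv_diag_le_of_holomorphicSlice {P : V → ℝ} {O : Set V} (hO : IsOpen O) {n : ℕ}
    (hP : ContDiffOn ℝ n P O) {x : V} (hx : x ∈ O) {v : V} {g : ℂ → ℂ} {S : Set ℂ} (hS : IsOpen S)
    (hg : DifferentiableOn ℂ g S) {r M : ℝ} (hr : 0 < r) (hsub : closedBall (0 : ℂ) r ⊆ S)
    (hM : ∀ t ∈ sphere (0 : ℂ) r, ‖g t‖ ≤ M) (hslice : ∀ s : ℝ, (s : ℂ) ∈ S → P (x + s • v) = (g s).re) :
    |iteratedFDeriv ℝ n P x (fun _ => v)| ≤ n.factorial * M / r ^ n := by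
  rw [← iteratedDeriv_lineSlice hO hP hx v]
  have h0 : ((0 : ℝ) : ℂ) ∈ S := by simpa using hsub (mem_closedBall_self hr.le)
  have hev : ∀ᶠ s : ℝ in 𝓝 0, (s : ℂ) ∈ S := Complex.continuous_ofReal.continuousAt.preimage_mem_nhds (hS.mem_nhds h0)
  rw [Filter.EventuallyEq.iteratedDeriv_eq n (hev.mono fun s hs => hslice s hs)]
  exact abs_iteratedDeriv_re_le hS hg n hr (by simpa using hsub) (by simpa using hM)

end LineSlice

/-! ## §3 Through a real-linear chart `J : V →L[ℝ] W` into a complex normed space (`P y = Re E(J y)`): the diagonal letter of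
every order -/

section Chart

variable {V : Type*} [NormedAddCommGroup V] [NormedSpace ℝ V] {W : Type*} [NormedAddCommGroup W] [NormedSpace ℂ W]
  {E : W → ℂ} {U : Set W} {M : ℝ}

/-- **DIAGONAL LETTER OF ORDER `n`, ANY CHART, DISC FORM**: `E ∈ Cⁿ(U)` over `ℂ` (`n ≠ 0`), `‖E‖ ≤ M` on `U`, and the closed complex
disc `{J x + t·J v : |t| ≤ r}` inside `U` ⟹ `|DⁿP(x)[v, …, v]| ≤ n!·M∕rⁿ` for `P y = Re E(J y)`. [folklore] -/
theorem abs_iteratedFDeriv_diag_chart_le_of_disc (J : V →L[ℝ] W) (hU : IsOpen U) {n : ℕ} (hn : n ≠ 0)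
    (hE : ContDiffOn ℂ n E U) (hM : ∀ q ∈ U, ‖E q‖ ≤ M) {x v : V} {r : ℝ} (hr : 0 < r)
    (hsub : ∀ t : ℂ, ‖t‖ ≤ r → J x + t • J v ∈ U) :
    |iteratedFDeriv ℝ n (fun y => (E (J y)).re) x (fun _ => v)| ≤ n.factorial * M / r ^ n := by
  have hx : x ∈ J ⁻¹' U := by simpa using hsub 0 (by simpa using hr.le)
  have hP : ContDiffOn ℝ n (fun y => (E (J y)).re) (J ⁻¹' U) :=   -- the regularity letter (as in the siblings)
    (Complex.reCLM.contDiff.comp_contDiffOn (hE.restrict_scalars ℝ)).comp J.contDiff.contDiffOn (mapsTo_preimage _ _)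
  have hEd : DifferentiableOn ℂ E U := hE.differentiableOn (by exact_mod_cast hn)
  have hSo : IsOpen ((fun t : ℂ => J x + t • J v) ⁻¹' U) := hU.preimage (by fun_prop)
  have hgS : DifferentiableOn ℂ (fun t : ℂ => E (J x + t • J v)) ((fun t : ℂ => J x + t • J v) ⁻¹' U) :=
    hEd.comp ((differentiable_const _).add (differentiable_id.smul_const _)).differentiableOn (mapsTo_preimage _ _)
  exact abs_iteratedFDeriv_diag_le_of_holomorphicSlice (hU.preimage J.continuous) hP hx hSo hgS hr
    (fun t ht => hsub t (by simpa using ht)) (fun t ht => hM _ (hsub t (le_of_eq (by simpa using ht))))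
    (fun s _ => by simp [map_add, map_smul])

/-- **DIAGONAL LETTER OF ORDER `n`** (contractive chart `‖J v‖ ≤ ‖v‖`, `closedBall (J x) δ ⊆ U`, `E ∈ Cⁿ(U)`, `n ≠ 0`):
`|DⁿP(x)[v, …, v]| ≤ (n!·M∕δⁿ)‖v‖ⁿ` — one sup bound buys every derivative. [folklore] -/
theorem abs_iteratedFDeriv_diag_chart_le (J : V →L[ℝ] W) (hJ : ∀ v, ‖J v‖ ≤ ‖v‖) (hU : IsOpen U) {n : ℕ} (hn : n ≠ 0)
    (hE : ContDiffOn ℂ n E U) (hM : ∀ q ∈ U, ‖E q‖ ≤ M) {x : V} {δ : ℝ} (hδ : 0 < δ) (hsub : closedBall (J x) δ ⊆ U)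
    (v : V) : |iteratedFDeriv ℝ n (fun y => (E (J y)).re) x (fun _ => v)| ≤ n.factorial * M / δ ^ n * ‖v‖ ^ n := by
  by_cases hv : v = 0
  · subst hv
    haveI : Nonempty (Fin n) := ⟨⟨0, Nat.pos_of_ne_zero hn⟩⟩
    have h0 : (fun _ : Fin n => (0 : V)) = 0 := rfl
    rw [h0, ContinuousMultilinearMap.map_zero]
    simp [hn]
  have hvn : 0 < ‖v‖ := norm_pos_iff.mpr hv
  -- the contractive chart sends `J x + t·J v`, `|t| ≤ δ∕‖v‖`, into `closedBall (J x) δ ⊆ U`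
  have hdisc : ∀ t : ℂ, ‖t‖ ≤ δ / ‖v‖ → J x + t • J v ∈ U := fun t ht => hsub (by
    rw [mem_closedBall, dist_eq_norm, add_sub_cancel_left, norm_smul]
    calc ‖t‖ * ‖J v‖ ≤ δ / ‖v‖ * ‖v‖ := mul_le_mul ht (hJ v) (norm_nonneg _) ((norm_nonneg t).trans ht)
      _ = δ := div_mul_cancel₀ δ hvn.ne')
  have h := abs_iteratedFDeriv_diag_chart_le_of_disc J hU hn hE hM (div_pos hδ hvn) hdisc
  calc |iteratedFDeriv ℝ n (fun y => (E (J y)).re) x (fun _ => v)| ≤ n.factorial * M / (δ / ‖v‖) ^ n := h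
    _ = n.factorial * M / δ ^ n * ‖v‖ ^ n := by rw [div_pow]; field_simp

end Chart

/-! ## §4 ORDER THREE: Schwarz symmetry, cubic polarization, the mixed letter and the operator norm -/

section Cubic

variable {V : Type*} [NormedAddCommGroup V] [NormedSpace ℝ V] {F : Type*} [NormedAddCommGroup F] [NormedSpace ℝ F]

/-- `D³P(x)[m] = D(D(DP))(x)(m 0)(m 1)(m 2)` — the third derivative in `fderiv ∘ fderiv ∘ fderiv` currency (the order-three
analogue of Mathlib's `iteratedFDeriv_two_apply`). [folklore] -/
theorem iteratedFDeriv_three_apply (P : V → F) (x : V) (m : Fin 3 → V) :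
    iteratedFDeriv ℝ 3 P x m = fderiv ℝ (fderiv ℝ (fderiv ℝ P)) x (m 0) (m 1) (m 2) := by
  rw [iteratedFDeriv_succ_apply_right, iteratedFDeriv_two_apply]
  rfl

/-- **SCHWARZ SYMMETRY AT ORDER THREE** (the tree's all-orders Schwarz–Clairaut theorem `…IteratedFDerivSymmetric` BY NAME): for `P`
of class `C³` at `x`, `D³P(x)[b,a,c] = D³P(x)[a,b,c] = D³P(x)[a,c,b]`. [folklore] -/
theorem fderiv_three_symm {P : V → F} {x : V} (hP : ContDiffAt ℝ 3 P x) (a b c : V) :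
    fderiv ℝ (fderiv ℝ (fderiv ℝ P)) x b a c = fderiv ℝ (fderiv ℝ (fderiv ℝ P)) x a b c ∧
      fderiv ℝ (fderiv ℝ (fderiv ℝ P)) x a c b = fderiv ℝ (fderiv ℝ (fderiv ℝ P)) x a b c := by
  have hm : ((3 : ℕ) : WithTop ℕ∞) ≤ 3 := le_of_eq (by norm_cast)
  have h01 := Literature.Analysis.Calculus.iteratedFDeriv_comp_perm_of_le hP hm ![a, b, c] (Equiv.swap 0 1)
  have h12 := Literature.Analysis.Calculus.iteratedFDeriv_comp_perm_of_le hP hm ![a, b, c] (Equiv.swap 1 2)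
  simp [iteratedFDeriv_three_apply, Equiv.swap_apply_def] at h01 h12
  exact ⟨h01, h12⟩

/-- **CUBIC POLARIZATION**: for `P : V → ℝ` of class `C³` at `x`, with `D(z) := D³P(x)[z,z,z]`,
`24·D³P(x)[u,v,w] = D(u+v+w) − D(u+v−w) − D(u−v+w) + D(u−v−w)` (multilinearity kills every word except the six permutations of
`uvw`; Schwarz symmetry identifies them). [folklore] -/
theorem polarization_three {P : V → ℝ} {x : V} (hP : ContDiffAt ℝ 3 P x) (u v w : V) :
    24 * fderiv ℝ (fderiv ℝ (fderiv ℝ P)) x u v w =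
      fderiv ℝ (fderiv ℝ (fderiv ℝ P)) x (u + v + w) (u + v + w) (u + v + w)
        - fderiv ℝ (fderiv ℝ (fderiv ℝ P)) x (u + v - w) (u + v - w) (u + v - w)
        - fderiv ℝ (fderiv ℝ (fderiv ℝ P)) x (u - v + w) (u - v + w) (u - v + w)
        + fderiv ℝ (fderiv ℝ (fderiv ℝ P)) x (u - v - w) (u - v - w) (u - v - w) := by
  set B := fderiv ℝ (fderiv ℝ (fderiv ℝ P)) x with hB
  have h1 : B u w v = B u v w := (fderiv_three_symm hP u v w).2
  have h2 : B v u w = B u v w := (fderiv_three_symm hP u v w).1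
  have h3 : B v w u = B u v w := by rw [(fderiv_three_symm hP v u w).2, h2]
  have h4 : B w u v = B u v w := by rw [(fderiv_three_symm hP u w v).1, h1]
  have h5 : B w v u = B u v w := by rw [(fderiv_three_symm hP w u v).2, h4]
  simp only [map_add, map_sub, _root_.add_apply, _root_.sub_apply]
  rw [h1, h2, h3, h4, h5]
  ring

variable {W : Type*} [NormedAddCommGroup W] [NormedSpace ℂ W] {E : W → ℂ} {U : Set W} {M : ℝ}

/-- **THE MIXED THIRD-DERIVATIVE LETTER** (contractive chart `‖J v‖ ≤ ‖v‖`, `closedBall (J x) δ ⊆ U`, `E ∈ C³(U)` over `ℂ`,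
`‖E‖ ≤ M` on `U`): `|D³P(x)[u,v,w]| ≤ (27M∕δ³)‖u‖‖v‖‖w‖` for `P y = Re E(J y)` — the diagonal letter `6M∕δ³` at the four points
`û ± v̂ ± ŵ` of norm `≤ 3` through cubic polarization (`4·27·6∕24 = 27 = 3³`, the several-variable Cauchy constant), then
homogeneity. [folklore] -/
theorem abs_fderiv_three_chart_le (J : V →L[ℝ] W) (hJ : ∀ v, ‖J v‖ ≤ ‖v‖) (hU : IsOpen U) (hE : ContDiffOn ℂ 3 E U)
    (hM : ∀ q ∈ U, ‖E q‖ ≤ M) {x : V} {δ : ℝ} (hδ : 0 < δ) (hsub : closedBall (J x) δ ⊆ U) (u v w : V) :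
    |fderiv ℝ (fderiv ℝ (fderiv ℝ (fun y => (E (J y)).re))) x u v w| ≤ 27 * M / δ ^ 3 * ‖u‖ * ‖v‖ * ‖w‖ := by
  set B := fderiv ℝ (fderiv ℝ (fderiv ℝ (fun y => (E (J y)).re))) x with hB
  have hx : x ∈ J ⁻¹' U := hsub (mem_closedBall_self hδ.le)
  have hM0 : 0 ≤ M := (norm_nonneg _).trans (hM _ hx)
  have hPat : ContDiffAt ℝ 3 (fun y => (E (J y)).re) x :=
    ((Complex.reCLM.contDiff.comp_contDiffOn (hE.restrict_scalars ℝ)).comp J.contDiff.contDiffOn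
      (mapsTo_preimage _ U)).contDiffAt ((hU.preimage J.continuous).mem_nhds hx)
  have hdiag : ∀ a : V, |B a a a| ≤ 6 * M / δ ^ 3 * ‖a‖ ^ 3 := by
    intro a
    have h := abs_iteratedFDeriv_diag_chart_le J hJ hU (n := 3) (by norm_num) hE hM hδ hsub a
    rw [iteratedFDeriv_three_apply, show ((Nat.factorial 3 : ℕ) : ℝ) = 6 by rfl] at h
    exact h
  -- the unit ball
  have key : ∀ a b c : V, ‖a‖ ≤ 1 → ‖b‖ ≤ 1 → ‖c‖ ≤ 1 → |B a b c| ≤ 27 * M / δ ^ 3 := by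
    intro a b c ha hb hc
    have hD : ∀ z : V, ‖z‖ ≤ 3 → |B z z z| ≤ 6 * M / δ ^ 3 * 27 := by
      intro z hz
      refine (hdiag z).trans (mul_le_mul_of_nonneg_left ?_ (by positivity))
      calc ‖z‖ ^ 3 ≤ 3 ^ 3 := pow_le_pow_left₀ (norm_nonneg z) hz 3
        _ = 27 := by norm_num
    have e1 := hD _ (by linarith [norm_add₃_le (a := a) (b := b) (c := c)] : ‖a + b + c‖ ≤ 3)
    have e2 := hD _ (by linarith [norm_sub_le (a + b) c, norm_add_le a b] : ‖a + b - c‖ ≤ 3)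
    have e3 := hD _ (by linarith [norm_add_le (a - b) c, norm_sub_le a b] : ‖a - b + c‖ ≤ 3)
    have e4 := hD _ (by linarith [norm_sub_le (a - b) c, norm_sub_le a b] : ‖a - b - c‖ ≤ 3)
    have quad : ∀ p q r t : ℝ, |p - q - r + t| ≤ |p| + |q| + |r| + |t| := fun p q r t => by
      linarith [abs_add_le (p - q - r) t, abs_sub (p - q) r, abs_sub p q]
    have h24 : |24 * B a b c| ≤ 4 * (6 * M / δ ^ 3 * 27) := by
      rw [polarization_three hPat a b c]; exact (quad _ _ _ _).trans (by linarith)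
    have e24 : (4 : ℝ) * (6 * M / δ ^ 3 * 27) = 24 * (27 * M / δ ^ 3) := by ring
    rw [abs_mul, abs_of_pos (by norm_num : (0 : ℝ) < 24), e24] at h24
    linarith
  -- homogeneity: `z = ‖z‖ • (‖z‖⁻¹ • z)` with `‖z‖⁻¹ • z` in the unit ball (also for `z = 0`)
  have hn : ∀ z : V, ‖z‖ • (‖z‖⁻¹ • z) = z ∧ ‖‖z‖⁻¹ • z‖ ≤ 1 := fun z => by
    rcases eq_or_ne z 0 with rfl | hz
    · simp
    · have hz' : ‖z‖ ≠ 0 := norm_ne_zero_iff.mpr hz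
      exact ⟨smul_inv_smul₀ hz' z, by rw [norm_smul, norm_inv, norm_norm, inv_mul_cancel₀ hz']⟩
  have k := key _ _ _ (hn u).2 (hn v).2 (hn w).2
  have e : B u v w = ‖u‖ * (‖v‖ * (‖w‖ * B (‖u‖⁻¹ • u) (‖v‖⁻¹ • v) (‖w‖⁻¹ • w))) := by
    conv_lhs => rw [← (hn u).1, ← (hn v).1, ← (hn w).1]
    simp only [map_smul, _root_.smul_apply, smul_eq_mul]; ring
  rw [e, abs_mul, abs_mul, abs_mul, abs_norm, abs_norm, abs_norm]
  calc ‖u‖ * (‖v‖ * (‖w‖ * |B (‖u‖⁻¹ • u) (‖v‖⁻¹ • v) (‖w‖⁻¹ • w)|)) ≤ ‖u‖ * (‖v‖ * (‖w‖ * (27 * M / δ ^ 3))) := by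
        gcongr
    _ = 27 * M / δ ^ 3 * ‖u‖ * ‖v‖ * ‖w‖ := by ring

/-- The same letter in `iteratedFDeriv ℝ 3 P x ![u, v, w]` currency (the shape of `…ConvexWindowSuppliersBox`'s anisotropic letter
with `N = ‖·‖`). [folklore] -/
theorem abs_iteratedFDeriv_three_chart_le (J : V →L[ℝ] W) (hJ : ∀ v, ‖J v‖ ≤ ‖v‖) (hU : IsOpen U) (hE : ContDiffOn ℂ 3 E U)
    (hM : ∀ q ∈ U, ‖E q‖ ≤ M) {x : V} {δ : ℝ} (hδ : 0 < δ) (hsub : closedBall (J x) δ ⊆ U) (u v w : V) :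
    |iteratedFDeriv ℝ 3 (fun y => (E (J y)).re) x ![u, v, w]| ≤ 27 * M / δ ^ 3 * ‖u‖ * ‖v‖ * ‖w‖ := by
  rw [iteratedFDeriv_three_apply]
  exact abs_fderiv_three_chart_le J hJ hU hE hM hδ hsub u v w

/-- **THE THIRD-DERIVATIVE LETTER, OPERATOR NORM** (contractive chart, `closedBall (J x) δ ⊆ U`, `E ∈ C³(U)`, `‖E‖ ≤ M` on `U`):
`‖D³P(x)‖ ≤ 27M∕δ³`. [folklore] -/
theorem norm_iteratedFDeriv_three_chart_le (J : V →L[ℝ] W) (hJ : ∀ v, ‖J v‖ ≤ ‖v‖) (hU : IsOpen U) (hE : ContDiffOn ℂ 3 E U)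
    (hM : ∀ q ∈ U, ‖E q‖ ≤ M) {x : V} {δ : ℝ} (hδ : 0 < δ) (hsub : closedBall (J x) δ ⊆ U) :
    ‖iteratedFDeriv ℝ 3 (fun y => (E (J y)).re) x‖ ≤ 27 * M / δ ^ 3 := by
  have hM0 : 0 ≤ M := (norm_nonneg _).trans (hM _ (hsub (mem_closedBall_self hδ.le)))
  refine ContinuousMultilinearMap.opNorm_le_bound (by positivity) fun m => ?_
  rw [iteratedFDeriv_three_apply, Fin.prod_univ_three, Real.norm_eq_abs]
  calc |fderiv ℝ (fderiv ℝ (fderiv ℝ (fun y => (E (J y)).re))) x (m 0) (m 1) (m 2)|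
        ≤ 27 * M / δ ^ 3 * ‖m 0‖ * ‖m 1‖ * ‖m 2‖ := abs_fderiv_three_chart_le J hJ hU hE hM hδ hsub (m 0) (m 1) (m 2)
    _ = 27 * M / δ ^ 3 * (‖m 0‖ * ‖m 1‖ * ‖m 2‖) := by ring

/-- **THE ROAD's WINDOW LETTER `c₃`** (the `hP3` hypothesis shape of `…ConvexWindowSuppliers.norm_hessian_le_of_thirdDeriv_le` ∕
`firstOrderOn_quadratic_add_of_thirdDeriv`): if the closed complex `δ`-ball about every chart image `J x`, `x ∈ K`, lies in `U`, then
`∀ x ∈ K, ‖D³P(x)‖ ≤ 27M∕δ³` — `c₃ = 27M∕δ³` in print's currency `(M, δ)`. [folklore] -/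
theorem thirdDerivOn_chart_norm_le (J : V →L[ℝ] W) (hJ : ∀ v, ‖J v‖ ≤ ‖v‖) (hU : IsOpen U) (hE : ContDiffOn ℂ 3 E U)
    (hM : ∀ q ∈ U, ‖E q‖ ≤ M) {K : Set V} {δ : ℝ} (hδ : 0 < δ) (hK : ∀ x ∈ K, closedBall (J x) δ ⊆ U) :
    ∀ x ∈ K, ‖iteratedFDeriv ℝ 3 (fun y => (E (J y)).re) x‖ ≤ 27 * M / δ ^ 3 :=
  fun x hx => norm_iteratedFDeriv_three_chart_le J hJ hU hE hM hδ (hK x hx)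

end Cubic

/-! ## §5 On the complex space itself (`J = id`, `P̃ q = Re E(q)`) -/

section Self

variable {W : Type*} [NormedAddCommGroup W] [NormedSpace ℂ W] {E : W → ℂ} {U : Set W} {M : ℝ}

/-- **DIAGONAL LETTER OF ORDER `n` ON `W`**: `E ∈ Cⁿ(U)` over `ℂ` (`n ≠ 0`), `‖E‖ ≤ M` on `U`, `closedBall p δ ⊆ U` ⟹
`|Dⁿ(Re E)(p)[z, …, z]| ≤ (n!·M∕δⁿ)‖z‖ⁿ` (derivatives over `ℝ`). [folklore] -/
theorem abs_iteratedFDeriv_diag_re_le (hU : IsOpen U) {n : ℕ} (hn : n ≠ 0) (hE : ContDiffOn ℂ n E U)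
    (hM : ∀ q ∈ U, ‖E q‖ ≤ M) {p : W} {δ : ℝ} (hδ : 0 < δ) (hsub : closedBall p δ ⊆ U) (z : W) :
    |iteratedFDeriv ℝ n (fun q => (E q).re) p (fun _ => z)| ≤ n.factorial * M / δ ^ n * ‖z‖ ^ n :=
  abs_iteratedFDeriv_diag_chart_le (ContinuousLinearMap.id ℝ W) (fun _ => le_rfl) hU hn hE hM hδ (by simpa using hsub) z

/-- **THIRD-DERIVATIVE LETTER ON `W`, OPERATOR NORM**: `‖D³(Re E)(p)‖ ≤ 27M∕δ³`. [folklore] -/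
theorem norm_iteratedFDeriv_three_re_le (hU : IsOpen U) (hE : ContDiffOn ℂ 3 E U) (hM : ∀ q ∈ U, ‖E q‖ ≤ M) {p : W}
    {δ : ℝ} (hδ : 0 < δ) (hsub : closedBall p δ ⊆ U) : ‖iteratedFDeriv ℝ 3 (fun q => (E q).re) p‖ ≤ 27 * M / δ ^ 3 :=
  norm_iteratedFDeriv_three_chart_le (ContinuousLinearMap.id ℝ W) (fun _ => le_rfl) hU hE hM hδ (by simpa using hsub)

end Self

/-! ## §6 Lattice fields: `V = ι → ℝ`, `W = ι → ℂ`, componentwise complexification, SUP norms (closed balls are polydiscs) -/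

section Lattice

variable {ι : Type*} [Fintype ι] {E : (ι → ℂ) → ℂ} {U : Set (ι → ℂ)} {M : ℝ}

/-- **THIRD-DERIVATIVE LETTER FOR LATTICE FIELDS, OPERATOR NORM**: `E ∈ C³(U)` over `ℂ` on an open `U ⊆ ι → ℂ`, `‖E‖ ≤ M` on `U`,
and the closed polydisc of radius `δ` about the real field `x` inside `U` ⟹ `‖D³(y ↦ Re E(↑y))(x)‖ ≤ 27M∕δ³` (sup norms; the
componentwise complexification chart preserves the sup norm). [folklore] -/
theorem norm_iteratedFDeriv_three_lattice_le (hU : IsOpen U) (hE : ContDiffOn ℂ 3 E U) (hM : ∀ q ∈ U, ‖E q‖ ≤ M)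
    {x : ι → ℝ} {δ : ℝ} (hδ : 0 < δ) (hsub : closedBall (fun i => (x i : ℂ)) δ ⊆ U) :
    ‖iteratedFDeriv ℝ 3 (fun y : ι → ℝ => (E (fun i => (y i : ℂ))).re) x‖ ≤ 27 * M / δ ^ 3 := by
  set J : (ι → ℝ) →L[ℝ] (ι → ℂ) := ContinuousLinearMap.pi fun i => Complex.ofRealCLM.comp (ContinuousLinearMap.proj i)
    with hJ
  have hJa : ∀ y : ι → ℝ, J y = fun i => (y i : ℂ) := fun y => by ext i; simp [hJ]
  have hJn : ∀ y : ι → ℝ, ‖J y‖ = ‖y‖ := fun y => by rw [hJa]; simp [Pi.norm_def]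
  have hP : (fun y : ι → ℝ => (E (fun i => (y i : ℂ))).re) = fun y => (E (J y)).re := by
    funext y; rw [hJa]
  rw [hP]
  exact norm_iteratedFDeriv_three_chart_le J (fun y => (hJn y).le) hU hE hM hδ (by rwa [hJa])

/-- **THE THIRD-DERIVATIVE TABLE FOR LATTICE FIELDS**: every coordinate third partial of `y ↦ Re E(↑y)` at `x` is bounded by
`27M∕δ³` — `|D³P(x)[e_a, e_b, e_c]| ≤ 27M∕δ³` for the coordinate vectors `e_a = Pi.single a 1` (sup norm `1`). [folklore] -/
theorem abs_iteratedFDeriv_three_lattice_single_le [DecidableEq ι] (hU : IsOpen U) (hE : ContDiffOn ℂ 3 E U)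
    (hM : ∀ q ∈ U, ‖E q‖ ≤ M) {x : ι → ℝ} {δ : ℝ} (hδ : 0 < δ) (hsub : closedBall (fun i => (x i : ℂ)) δ ⊆ U)
    (r : Fin 3 → ι) :
    |iteratedFDeriv ℝ 3 (fun y : ι → ℝ => (E (fun i => (y i : ℂ))).re) x (fun s => Pi.single (r s) (1 : ℝ))| ≤
      27 * M / δ ^ 3 := by
  have h := (iteratedFDeriv ℝ 3 (fun y : ι → ℝ => (E (fun i => (y i : ℂ))).re) x).le_opNorm (fun s => Pi.single (r s) (1 : ℝ))
  simp only [Pi.norm_single, norm_one, Finset.prod_const_one, mul_one, Real.norm_eq_abs] at h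
  exact h.trans (norm_iteratedFDeriv_three_lattice_le hU hE hM hδ hsub)

end Lattice

/-! ## §7 Toy: the hypotheses are jointly inhabited (`E z = z³` on `ball 0 2 ⊆ ℂ`, `M = 8`, `δ = 1`) -/

/-- Toy instance of `norm_iteratedFDeriv_three_re_le`: for `E z = z³`, holomorphic with `‖E‖ ≤ 8` on `ball 0 2`, and `δ = 1`:
`‖D³(Re z³)(0)‖ ≤ 27·8` (the true third derivative is the constant form `6·Re(uvw)`). [folklore] -/
example : ‖iteratedFDeriv ℝ 3 (fun q : ℂ => (q ^ 3).re) 0‖ ≤ 27 * 8 / 1 ^ 3 := by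
  refine norm_iteratedFDeriv_three_re_le (E := fun q : ℂ => q ^ 3) (U := ball (0 : ℂ) 2) (M := 8) isOpen_ball
    ((contDiff_id.pow 3).contDiffOn) ?_ one_pos ?_
  · intro q hq
    rw [norm_pow]
    nlinarith [pow_le_pow_left₀ (norm_nonneg q) (le_of_lt (by simpa using hq : ‖q‖ < 2)) 3]
  · simpa using (closedBall_subset_ball (by norm_num : (1 : ℝ) < 2))

end Summit.QuantumFields.BalabanUV.T4Continuum.NE7b.AnalyticThirdDerivLetter
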